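import Literature.IUT.HodgeTheaters.StableCurveTemperedDataOfSpecialFibreTower
import Literature.IUT.HodgeTheaters.TemperedCoveringsChartsAtCountable
import Literature.AnabelianGeometry.SemiGraphs.TemperedCompactInVerticialAtBridge
import HarnessLib

/-!
# [IUTchI] Prop. 2.4 (i) at the genuine 𝔛-data: "Proposition 2.1 [applied to `𝔾_J`]" at every level BY NAME

Mochizuki, *Inter-universal Teichmüller theory I*, kurims manuscript (May 2020), §2, proof of Prop. 2.4 (i)
p. 50 l. 37 ("it thus follows from Proposition 2.1 [applied to `𝔾_J`] that …") and Prop. 2.1 p. 45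
[cite: Mochizuki2012, Prop 2.4(i) p.50; Prop 2.1 p.45] (D-0012 claim key; nothing of the series is asserted
here).

PROOF-ONLY companion of `StableCurveTemperedDataOfSpecialFibreTower.lean` (abc-iut-L5-t11; no definitions).
For the level data `towerOfSpecialFibreTower X d T …` of the genuine 𝔛-data, the sub-DAG input `Prop21Levels`
("Prop. 2.1 for every level graph `𝔾_{J_i}`") is reduced to the [SemiAnbd]/[NodNon] inputs of abc-iut-L5-t11's
`TemperedGraphGroupData.prop21_of_chart_at'` (abc-iut-w5-d111, no (RF)/Galois-domination binder) BY NAME, level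
by level, with the chart `c := T.chart i`, `e := refl`, `h𝒢 := T.hyp i` (a FIELD of the tower) and `Π̂` Hausdorff
(`ofChart_isProfiniteCompletion`) supplied: what remains per level is Thm 3.7 (iii) AT the level graph
(`CompactInVerticialAt (T.Gc i)` — for FINITE special fibres the deliverable of L3's φ2 producer,
`compactInVerticialAt_of_finite`; from the global named fact by `compactInVerticialAt_of_compactInVerticial`), a
verticial family (exists: `exists_verticialFamily_of_prop36`) and the node data with (A3) ([NodNon] Lem 1.9 (ii)).
Capstone `prop24i_ofSpecialFibre_byName`.  Also the level bookkeeping consumers need (`levelJhat_le_iff`,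
`levelJhat_antitone`, `piHatLevel_surjective`, `closure_map_ker_adm_le_ker_piHatLevel` — the easy half of the
kernel identification).  Typed ≠ discharged for those inputs; nothing here bears on [IUTchIII] Cor. 3.12.
-/

noncomputable section

namespace Literature.IUT.HodgeTheaters

open Topology Pointwise
open Literature.AnabelianGeometry.SemiGraphs Literature.AnabelianGeometry.SemiGraphs.ProfiniteSemiGraph

namespace StableCurveTemperedData

namespace OfSpecialFibre

variable {p : ℕ} [Fact p.Prime] (X : TemperedCurve p) (d : X.GroupLevelData)
  (T : SpecialFibreTower X.DeltaTemp)
  (Sigma SigmaHat : Set ℕ) (hsub : Sigma ⊆ SigmaHat) (hne : Sigma.Nonempty)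
  (hprime : ∀ q ∈ SigmaHat, q.Prime)

/-! ### Level bookkeeping: monotonicity, surjectivity, the easy half of the kernel -/

include d in
/-- `Ĵ_j ∩ Δ_X ≤ Ĵ_i ∩ Δ_X ↔ N_j ≤ N_i` (closures of open finite-index subgroups in the completion are
order-reflecting: `comap_levelHat`). ([IUTchI] Prop 2.4(i) p.50) [claim: Mochizuki2012, status: disputed] -/
theorem levelHat_le_iff (i j : ℕ) : levelHat X T j ≤ levelHat X T i ↔ T.N j ≤ T.N i := by
  constructor
  · intro h
    rw [← comap_levelHat X d T j, ← comap_levelHat X d T i]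
    exact Subgroup.comap_mono h
  · intro h
    exact Subgroup.topologicalClosure_mono (Subgroup.map_mono h)

include d in
/-- `Ĵ_j ≤ Ĵ_i ↔ N_j ≤ N_i`. ([IUTchI] Prop 2.4(i) p.50) [claim: Mochizuki2012, status: disputed] -/
theorem levelJhat_le_iff (i j : ℕ) : levelJhat X T j ≤ levelJhat X T i ↔ T.N j ≤ T.N i := by
  rw [← levelHat_le_iff X d T i j]
  constructor
  · intro h z hz
    have hz' : (z : X.PiHat) ∈ levelJhat X T i := h ⟨z, hz, rfl⟩
    obtain ⟨_, h2⟩ := (mem_levelJhat_iff X T).1 hz'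
    exact h2
  · intro h
    exact Subgroup.map_mono h

/-- The levels decrease: `i ≤ j → Ĵ_j ≤ Ĵ_i` (`N` is antitone). ([IUTchI] Prop 2.4(i) p.50) [claim: Mochizuki2012, status: disputed] -/
theorem levelJhat_antitone : Antitone (levelJhat X T) :=
  fun _ _ hij => Subgroup.map_mono (Subgroup.topologicalClosure_mono (Subgroup.map_mono (T.N_antitone hij)))

/-- `Ĵ_i ∩ Δ_X ↠ Π̂_{𝔾_{J_i}}` is SURJECTIVE ("the natural surjection on pro-`Σ̂` completions", p. 50 l. 33): its
image is compact, hence closed, and contains the dense image of `π₁^temp(𝒢_i)`.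
([IUTchI] Prop 2.4(i) p.50) [claim: Mochizuki2012, status: disputed] -/
theorem piHatLevel_surjective (i : ℕ) : Function.Surjective (piHatLevel X d T i) := by
  have hJ := iotaLevel_isProfiniteCompletion X d T i
  haveI : CompactSpace (levelHat X T i) := hJ.compactSpace
  have hG := (TemperedGraphGroupData.exists_completion_of_prop36 (T.Gc i) (T.hyp i).toProp36Hypotheses
    (T.chart i)).choose_spec.choose_spec.1
  haveI := hG.t2Space
  have hcl : IsClosed (Set.range (piHatLevel X d T i)) :=
    (isCompact_range (piHatLevel X d T i).continuous).isClosed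
  have hsub : Set.range (iotaGraph X T i) ⊆ Set.range (piHatLevel X d T i) := by
    rintro _ ⟨y, rfl⟩
    obtain ⟨n, rfl⟩ := T.adm_surjective i y
    exact ⟨iotaLevel X T i n, piHatLevel_iotaLevel X d T i n⟩
  have hdense : Dense (Set.range (piHatLevel X d T i)) := hG.denseRange.mono hsub
  rw [← Set.range_eq_univ, ← hcl.closure_eq]
  exact hdense.closure_eq

/-- The EASY half of "`Ker(Ĵ_i ↠ Π̂_{𝔾_{J_i}})` = closure of `ι(admKer_i)`": the closure of `ι(Ker adm_i)` is
killed by `piHatLevel` (which extends `ιG ∘ adm_i` and has closed kernel). ([IUTchI] Prop 2.4(i) p.50) [claim: Mochizuki2012, status: disputed] -/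
theorem closure_map_ker_adm_le_ker_piHatLevel (i : ℕ) :
    (((T.adm i).toMonoidHom.ker).map (iotaLevel X T i).toMonoidHom).topologicalClosure ≤
      (piHatLevel X d T i).toMonoidHom.ker := by
  have hG := (TemperedGraphGroupData.exists_completion_of_prop36 (T.Gc i) (T.hyp i).toProp36Hypotheses
    (T.chart i)).choose_spec.choose_spec.1
  haveI := hG.t2Space
  refine Subgroup.topologicalClosure_minimal _ ?_ ?_
  · rintro _ ⟨n, hn, rfl⟩
    have hn' : (T.adm i).toMonoidHom n = 1 := hn
    show piHatLevel X d T i (iotaLevel X T i n) = 1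
    rw [piHatLevel_iotaLevel]
    show iotaGraph X T i ((T.adm i).toMonoidHom n) = 1
    rw [hn', map_one]
  · exact isClosed_singleton.preimage (piHatLevel X d T i).continuous

/-- **Prop. 2.1 for the level graph `𝔾_{J_i}` BY NAME** (`prop21_of_chart_at'` at `D := levelGraph … i =
ofChart (𝒢^c_i)`, `c := T.chart i`, `e := refl`): from [SemiAnbd] Thm 3.7 (iii) AT `𝒢^c_i`
(`CompactInVerticialAt (T.Gc i)`), a verticial family `Λv` in the chart with the node data `src/tgt/c₁/c₂` and
their (A3) ([NodNon] Lem 1.9 (ii)); `Thm37Hypotheses` is the tower's field `hyp i`, `Π̂_{𝔾_{J_i}}` is Hausdorff as a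
profinite completion (`ofChart_isProfiniteCompletion`). [cite: Mochizuki2012, Prop 2.1 p.45] -/
theorem prop21_levelGraph_byName (i : ℕ) (hCV : CompactInVerticialAt (T.Gc i))
    (Λv : (T.Gc i).graph.Vertex → Subgroup (T.chart i).G)
    (hΛv : ∀ v, Λv v ∈ verticialSubgroups (T.chart i) v)
    {E : Type*} (src tgt : E → (T.Gc i).graph.Vertex) (c₁ c₂ : E → (T.chart i).G)
    (hA3 : ∀ (v w : (T.Gc i).graph.Vertex) (g h : (levelGraph X T Sigma SigmaHat hsub hne hprime i).Hat),
      MulAut.conj g • (Λv v).map (levelGraph X T Sigma SigmaHat hsub hne hprime i).ι ⊓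
          MulAut.conj h • (Λv w).map (levelGraph X T Sigma SigmaHat hsub hne hprime i).ι ≠ ⊥ →
        (v = w ∧ g⁻¹ * h ∈ (Λv v).map (levelGraph X T Sigma SigmaHat hsub hne hprime i).ι) ∨
        ∃ (e : E) (k : (levelGraph X T Sigma SigmaHat hsub hne hprime i).Hat),
          ∃ p ∈ (Λv (src e)).map (levelGraph X T Sigma SigmaHat hsub hne hprime i).ι,
          ∃ q ∈ (Λv (tgt e)).map (levelGraph X T Sigma SigmaHat hsub hne hprime i).ι,
            (src e = v ∧ tgt e = w ∧ g = k * (levelGraph X T Sigma SigmaHat hsub hne hprime i).ι (c₁ e) * p ∧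
                h = k * (levelGraph X T Sigma SigmaHat hsub hne hprime i).ι (c₂ e) * q) ∨
            (src e = w ∧ tgt e = v ∧ h = k * (levelGraph X T Sigma SigmaHat hsub hne hprime i).ι (c₁ e) * p ∧
                g = k * (levelGraph X T Sigma SigmaHat hsub hne hprime i).ι (c₂ e) * q)) :
    (levelGraph X T Sigma SigmaHat hsub hne hprime i).ProfiniteConjugatesOfCompactSubgroups := by
  haveI : T2Space (levelGraph X T Sigma SigmaHat hsub hne hprime i).Hat :=
    (TemperedGraphGroupData.ofChart_isProfiniteCompletion (T.Gc i) (T.hyp i).toProp36Hypotheses (T.chart i)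
      Sigma SigmaHat hsub hne hprime ⊤ ⊤ le_top).t2Space
  exact (levelGraph X T Sigma SigmaHat hsub hne hprime i).prop21_of_chart_at' (T.chart i)
    (ContinuousMulEquiv.refl _) (T.hyp i) hCV
    Λv (fun v => by
      convert hΛv v using 1
      ext x
      constructor
      · rintro ⟨y, hy, rfl⟩
        exact hy
      · intro hx
        exact ⟨x, hx, rfl⟩)
    src tgt c₁ c₂ hA3

/-- A verticial family exists in every level chart ([SemiAnbd] Thm 3.7 (i), `exists_verticialFamily_of_prop36`).
[cite: MochizukiSemiAnbd2006, Thm 3.7(i) p.40] -/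
theorem exists_verticialFamily_level (i : ℕ) :
    ∃ Λv : (T.Gc i).graph.Vertex → Subgroup (T.chart i).G, ∀ v, Λv v ∈ verticialSubgroups (T.chart i) v :=
  TemperedGraphGroupData.exists_verticialFamily_of_prop36 (T.Gc i) (T.hyp i).toProp36Hypotheses (T.chart i)

variable (S : SpecialFibreData (X.toTemperedArithmeticGroup d)) (h36 : S.Gc.Prop36Hypotheses)
  (hp : p ∉ Sigma) (TpH : Subgroup S.chart.G)
  (HatH : Subgroup (TemperedGraphGroupData.exists_completion_of_prop36 S.Gc h36 S.chart).choose)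
  (hle : TpH.map (TemperedGraphGroupData.exists_completion_of_prop36 S.Gc h36
    S.chart).choose_spec.choose.toMonoidHom ≤ HatH)
  (cuspMeetsH : {x : X.Pt // X.IsCusp x} → Prop)

/-- **[IUTchI] Prop. 2.4 (i) AS TYPED at the genuine 𝔛-data, every structural input discharged and the level
Prop. 2.1's BY NAME**: from [SemiAnbd] Thm 3.7 (iii) AT every level graph (`CompactInVerticialAt (T.Gc i)`),
per-level verticial families with
node data and (A3) ([NodNon] Lem 1.9 (ii)), "[Config] Rmk 1.2.2" (`StronglyTorsionFreeSigma`), the `p ∉ Σ`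
specialisation half (`SpecializationAb`), the inverse-limit detection (`DetectsTempered`), and the cofinality of
the `N_i` (`hcof`). [cite: Mochizuki2012, Prop 2.4(i) p.50] -/
theorem prop24i_ofSpecialFibre_byName
    (hcof : ∀ U : Subgroup X.DeltaTemp, IsOpen (U : Set X.DeltaTemp) → U.Normal → U.FiniteIndex →
      ∃ i, T.N i ≤ U)
    (hstf : (ofSpecialFibre X d S h36 Sigma SigmaHat hsub hne hprime hp TpH HatH hle cuspMeetsH).StronglyTorsionFreeSigma)
    (hCV : ∀ i, CompactInVerticialAt (T.Gc i))
    (Λv : ∀ i, (T.Gc i).graph.Vertex → Subgroup (T.chart i).G)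
    (hΛv : ∀ i v, Λv i v ∈ verticialSubgroups (T.chart i) v)
    (E : ℕ → Type) (src tgt : ∀ i, E i → (T.Gc i).graph.Vertex) (c₁ c₂ : ∀ i, E i → (T.chart i).G)
    (hA3 : ∀ i (v w : (T.Gc i).graph.Vertex) (g h : (levelGraph X T Sigma SigmaHat hsub hne hprime i).Hat),
      MulAut.conj g • (Λv i v).map (levelGraph X T Sigma SigmaHat hsub hne hprime i).ι ⊓
          MulAut.conj h • (Λv i w).map (levelGraph X T Sigma SigmaHat hsub hne hprime i).ι ≠ ⊥ →
        (v = w ∧ g⁻¹ * h ∈ (Λv i v).map (levelGraph X T Sigma SigmaHat hsub hne hprime i).ι) ∨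
        ∃ (e : E i) (k : (levelGraph X T Sigma SigmaHat hsub hne hprime i).Hat),
          ∃ p ∈ (Λv i (src i e)).map (levelGraph X T Sigma SigmaHat hsub hne hprime i).ι,
          ∃ q ∈ (Λv i (tgt i e)).map (levelGraph X T Sigma SigmaHat hsub hne hprime i).ι,
            (src i e = v ∧ tgt i e = w ∧
                g = k * (levelGraph X T Sigma SigmaHat hsub hne hprime i).ι (c₁ i e) * p ∧
                h = k * (levelGraph X T Sigma SigmaHat hsub hne hprime i).ι (c₂ i e) * q) ∨
            (src i e = w ∧ tgt i e = v ∧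
                h = k * (levelGraph X T Sigma SigmaHat hsub hne hprime i).ι (c₁ i e) * p ∧
                g = k * (levelGraph X T Sigma SigmaHat hsub hne hprime i).ι (c₂ i e) * q))
    (hspec : (towerOfSpecialFibreTower X d T Sigma SigmaHat hsub hne hprime S h36 hp TpH HatH hle cuspMeetsH).SpecializationAb)
    (hINV : (towerOfSpecialFibreTower X d T Sigma SigmaHat hsub hne hprime S h36 hp TpH HatH hle cuspMeetsH).DetectsTempered) :
    (ofSpecialFibre X d S h36 Sigma SigmaHat hsub hne hprime hp TpH HatH hle cuspMeetsH).Prop24i :=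
  prop24i_ofSpecialFibre_of_tower X d T Sigma SigmaHat hsub hne hprime S h36 hp TpH HatH hle cuspMeetsH hcof hstf
    (fun i => prop21_levelGraph_byName X T Sigma SigmaHat hsub hne hprime i (hCV i) (Λv i) (hΛv i) (src i) (tgt i)
      (c₁ i) (c₂ i) (hA3 i))
    hspec hINV

end OfSpecialFibre

end StableCurveTemperedData

end Literature.IUT.HodgeTheaters

end
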